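import Mathlib.Analysis.SpecialFunctions.Integrals.Basic
import Mathlib.Analysis.Calculus.IteratedDeriv.Lemmas
import Mathlib.MeasureTheory.Integral.IntervalIntegral.IntegrationByParts
import Mathlib.Analysis.SpecialFunctions.Trigonometric.Deriv
import HarnessLib

/-!
# Truncated Laplace transforms of smooth shapes: integration by parts, decay, positivity

Topic `Literature/NumberTheory/LFunctions` (auxiliary real/complex analysis for Heath-Brown's
test functions), sub-namespace `LaplaceShape`. Everything here is PROVED; `shapeLaplace` is glue.

For a real shape `φ` on `[0, X]` put `Φ(w) = shapeLaplace φ X w = ∫₀^X φ(t) e^{−wt} dt` (`w ∈ ℂ`).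

* `shapeLaplace_ibp` — one integration by parts:
  `Φ(w) = (φ(0) − φ(X)e^{−wX})/w + w⁻¹ ∫₀^X φ'(t)e^{−wt} dt` (`w ≠ 0`);
* `shapeLaplace_eq_sum_add` — **`k`-fold expansion** for a smooth `φ` flat at `X`
  (`φ^{(j)}(X) = 0` for all `j`): `Φ(w) = Σ_{j<k} φ^{(j)}(0)/w^{j+1} + w^{−k} ∫₀^X φ^{(k)}(t)e^{−wt} dt`
  — the source of the decay `F(z) ≪ |z|^{−k}` of Heath-Brown's Laplace transforms
  (Heath-Brown 1992, §7, conditions on `f`; Lemma 5.1 uses `|F₀| ≪ |z|⁻²`);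
* `norm_shapeLaplace_le` — `‖∫₀^X φ e^{−wt}‖ ≤ ∫₀^X |φ(t)| e^{−(Re w)t} dt`, and the cruder
  `≤ e^{max(0, −Re w)·X} ∫₀^X |φ|`;
* `re_shapeLaplace_nonneg_of_convex` — **positivity**: if `φ ∈ C²` with `φ'' ≥ 0` on `[0, X]`,
  `φ(X) = φ'(X) = 0`, then `Re Φ(iy) = ∫₀^X φ(t) cos(yt) dt = y⁻² ∫₀^X φ''(t)(1 − cos yt) dt ≥ 0`
  (two integrations by parts; Pólya's criterion in the compactly supported case) — Heath-Brown's
  Condition 2 `Re F(z) ≥ 0 (Re z ≥ 0)` for convex decreasing shapes (§7).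

## References

* D. R. Heath-Brown, Proc. London Math. Soc. (3) 64 (1992), Lemma 5.1 and §7 (Conditions 1, 2).
  [cite: HeathBrown1992PLMS, Lemma 5.1 and Section 7]
-/

noncomputable section

open Complex Real MeasureTheory Set intervalIntegral

namespace Literature.NumberTheory.LFunctions

namespace LaplaceShape

/-- The truncated Laplace transform `Φ(w) = ∫₀^X φ(t) e^{−wt} dt` of a real shape `φ`.
[cite: HeathBrown1992PLMS, Section 5 (F(z))] -/
def shapeLaplace (φ : ℝ → ℝ) (X : ℝ) (w : ℂ) : ℂ :=
  ∫ t in (0 : ℝ)..X, (φ t : ℂ) * Complex.exp (-(w * t))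

/-! ### One integration by parts -/

/-- **Integration by parts**: for `φ ∈ C¹` and `w ≠ 0`,
`∫₀^X φ e^{−wt} = (φ(0) − φ(X) e^{−wX})/w + w⁻¹ ∫₀^X φ' e^{−wt}`. [folklore] -/
theorem shapeLaplace_ibp {φ φ' : ℝ → ℝ} {X : ℝ}
    (hφ : ∀ t, HasDerivAt φ (φ' t) t) (hφ' : Continuous φ') {w : ℂ} (hw : w ≠ 0) :
    shapeLaplace φ X w = ((φ 0 : ℂ) - (φ X : ℂ) * Complex.exp (-(w * X))) / w +
      w⁻¹ * shapeLaplace φ' X w := by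
  -- `u = φ`, `v = −e^{−wt}/w`
  have hu : ∀ t ∈ uIcc (0 : ℝ) X, HasDerivAt (fun t : ℝ ↦ (φ t : ℂ)) ((φ' t : ℂ)) t := fun t _ ↦
    (hφ t).ofReal_comp
  have hv : ∀ t ∈ uIcc (0 : ℝ) X,
      HasDerivAt (fun t : ℝ ↦ -Complex.exp (-(w * t)) / w) (Complex.exp (-(w * t))) t := by
    intro t _
    have h1 : HasDerivAt (fun t : ℝ ↦ -(w * (t : ℂ))) (-w) t := by
      simpa using ((hasDerivAt_id (t : ℂ)).const_mul w).neg.comp_ofReal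
    have h2 := (h1.cexp).neg.div_const w
    have h3 : -(Complex.exp (-(w * (t : ℂ))) * -w) / w = Complex.exp (-(w * t)) := by
      rw [mul_neg, neg_neg, mul_div_assoc, div_self hw, mul_one]
    rw [h3] at h2
    exact h2
  have hφc : Continuous φ := continuous_iff_continuousAt.2 fun t ↦ (hφ t).continuousAt
  have hu' : IntervalIntegrable (fun t : ℝ ↦ ((φ' t : ℂ))) volume 0 X :=
    (continuous_ofReal.comp hφ').intervalIntegrable _ _
  have hv' : IntervalIntegrable (fun t : ℝ ↦ Complex.exp (-(w * t))) volume 0 X :=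
    (Continuous.cexp (by fun_prop)).intervalIntegrable _ _
  have key := integral_mul_deriv_eq_deriv_mul hu hv hu' hv'
  rw [shapeLaplace, shapeLaplace, key]
  simp only [ofReal_zero, mul_zero, neg_zero, Complex.exp_zero]
  rw [show (∫ x : ℝ in (0 : ℝ)..X, (φ' x : ℂ) * (-Complex.exp (-(w * x)) / w)) =
      -(w⁻¹ * ∫ x : ℝ in (0 : ℝ)..X, (φ' x : ℂ) * Complex.exp (-(w * x))) by
    rw [← intervalIntegral.integral_const_mul, ← intervalIntegral.integral_neg]
    refine intervalIntegral.integral_congr fun t _ ↦ ?_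
    field_simp]
  field_simp
  ring

/-! ### Bounds -/

/-- **The weighted bound** `‖∫₀^X φ e^{−wt}‖ ≤ ∫₀^X |φ(t)| e^{−(Re w) t} dt` (`X ≥ 0`, `φ`
continuous). [folklore] -/
theorem norm_shapeLaplace_le (φ : ℝ → ℝ) {X : ℝ} (hX : 0 ≤ X) (w : ℂ) :
    ‖shapeLaplace φ X w‖ ≤ ∫ t in (0 : ℝ)..X, |φ t| * Real.exp (-(w.re * t)) := by
  rw [shapeLaplace]
  refine (intervalIntegral.norm_integral_le_integral_norm hX).trans_eq ?_
  refine intervalIntegral.integral_congr fun t _ ↦ ?_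
  simp only [norm_mul, Complex.norm_real, Real.norm_eq_abs, Complex.norm_exp]
  congr 2
  simp [Complex.mul_re]

/-- **The crude bound** `‖∫₀^X φ e^{−wt}‖ ≤ e^{max(0, −Re w) X} ∫₀^X |φ|`. [folklore] -/
theorem norm_shapeLaplace_le_exp_mul {φ : ℝ → ℝ} (hφ : Continuous φ) {X : ℝ} (hX : 0 ≤ X) (w : ℂ) :
    ‖shapeLaplace φ X w‖ ≤ Real.exp (max 0 (-w.re) * X) * ∫ t in (0 : ℝ)..X, |φ t| := by
  refine (norm_shapeLaplace_le φ hX w).trans ?_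
  rw [← intervalIntegral.integral_const_mul]
  refine intervalIntegral.integral_mono_on hX ?_ ?_ fun t ht ↦ ?_
  · exact ((continuous_abs.comp hφ).mul (by fun_prop)).intervalIntegrable _ _
  · exact (continuous_const.mul (continuous_abs.comp hφ)).intervalIntegrable _ _
  · rw [mul_comm]
    refine mul_le_mul_of_nonneg_right (Real.exp_le_exp.2 ?_) (abs_nonneg _)
    have h1 : -(w.re * t) ≤ max 0 (-w.re) * t := by
      have := le_max_right 0 (-w.re)
      nlinarith [ht.1]
    have h2 : max 0 (-w.re) * t ≤ max 0 (-w.re) * X :=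
      mul_le_mul_of_nonneg_left ht.2 (le_max_left _ _)
    linarith

/-! ### The `k`-fold expansion for smooth shapes flat at `X` -/

/-- A smooth `φ` vanishing on `[X, ∞)` has all its derivatives `0` at `X`. [folklore] -/
theorem iteratedDeriv_eq_zero_of_eq_zero {φ : ℝ → ℝ} (hφ : ∀ m : ℕ, ContDiff ℝ m φ) {X : ℝ}
    (h0 : ∀ t, X ≤ t → φ t = 0) (j : ℕ) : iteratedDeriv j φ X = 0 := by
  -- on the open half-line `(X, ∞)` all derivatives vanish; conclude by continuity
  have hev : ∀ t, X < t → iteratedDeriv j φ t = 0 := by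
    intro t ht
    have hloc : φ =ᶠ[nhds t] fun _ ↦ (0 : ℝ) := by
      filter_upwards [Ioi_mem_nhds ht] with u hu using h0 u (le_of_lt hu)
    rw [hloc.iteratedDeriv_eq j, iteratedDeriv_const]
    simp
  have hcont : Continuous (iteratedDeriv j φ) :=
    (hφ j).continuous_iteratedDeriv j (by exact_mod_cast le_rfl)
  -- the limit from the right is both `iteratedDeriv j φ X` and `0`
  have h1 : Filter.Tendsto (iteratedDeriv j φ) (nhdsWithin X (Ioi X)) (nhds (iteratedDeriv j φ X)) :=
    tendsto_nhdsWithin_of_tendsto_nhds (hcont.tendsto X)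
  exact tendsto_nhds_unique h1 (by
    refine Filter.Tendsto.congr' ?_ tendsto_const_nhds
    filter_upwards [self_mem_nhdsWithin] with t ht
    exact (hev t ht).symm)

/-- **The `k`-fold expansion**: for a smooth `φ` vanishing on `[X, ∞)` (`X ≥ 0`) and `w ≠ 0`,
`∫₀^X φ e^{−wt} = Σ_{j<k} φ^{(j)}(0)/w^{j+1} + w^{−k} ∫₀^X φ^{(k)} e^{−wt}`.
[cite: HeathBrown1992PLMS, Section 7 (decay of F)] -/
theorem shapeLaplace_eq_sum_add {φ : ℝ → ℝ} (hφ : ∀ m : ℕ, ContDiff ℝ m φ) {X : ℝ}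
    (h0 : ∀ t, X ≤ t → φ t = 0) {w : ℂ} (hw : w ≠ 0) (k : ℕ) :
    shapeLaplace φ X w = ∑ j ∈ Finset.range k, ((iteratedDeriv j φ 0 : ℝ) : ℂ) / w ^ (j + 1) +
      (w ^ k)⁻¹ * shapeLaplace (iteratedDeriv k φ) X w := by
  induction k with
  | zero => simp
  | succ k ih =>
    rw [ih, Finset.sum_range_succ, add_assoc]
    congr 1
    -- one integration by parts on `φ^{(k)}`
    have hderiv : ∀ t, HasDerivAt (iteratedDeriv k φ) (iteratedDeriv (k + 1) φ t) t := by
      intro t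
      rw [iteratedDeriv_succ]
      exact (((hφ (k + 1)).differentiable_iteratedDeriv' k) t).hasDerivAt
    have hcont : Continuous (iteratedDeriv (k + 1) φ) :=
      (hφ (k + 1)).continuous_iteratedDeriv (k + 1) (by exact_mod_cast le_rfl)
    rw [shapeLaplace_ibp hderiv hcont hw, iteratedDeriv_eq_zero_of_eq_zero hφ h0 k]
    simp only [ofReal_zero, zero_mul, sub_zero]
    rw [pow_succ]
    field_simp

/-! ### Positivity for convex shapes -/

/-- **Two integrations by parts against `cos`**: for `φ ∈ C²` on `ℝ` with `φ(X) = φ'(X) = 0`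
and `y ≠ 0`, `∫₀^X φ(t) cos(yt) dt = y⁻² ∫₀^X φ''(t) (1 − cos(yt)) dt`. [folklore] -/
theorem integral_mul_cos_eq {φ φ' φ'' : ℝ → ℝ} {X : ℝ}
    (hφ : ∀ t, HasDerivAt φ (φ' t) t) (hφ' : ∀ t, HasDerivAt φ' (φ'' t) t) (hφ'' : Continuous φ'')
    (hX0 : φ X = 0) (hX1 : φ' X = 0) {y : ℝ} (hy : y ≠ 0) :
    ∫ t in (0 : ℝ)..X, φ t * Real.cos (y * t) =
      (y ^ 2)⁻¹ * ∫ t in (0 : ℝ)..X, φ'' t * (1 - Real.cos (y * t)) := by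
  have hφ'c : Continuous φ' := continuous_iff_continuousAt.2 fun t ↦ (hφ' t).continuousAt
  have hφc : Continuous φ := continuous_iff_continuousAt.2 fun t ↦ (hφ t).continuousAt
  -- first: `∫ φ cos = [φ sin/y] − ∫ φ' sin/y = −y⁻¹ ∫ φ' sin`
  have hsin : ∀ t, HasDerivAt (fun t : ℝ ↦ Real.sin (y * t) / y) (Real.cos (y * t)) t := by
    intro t
    have h := ((hasDerivAt_id' t).const_mul y).sin.div_const y
    have e : Real.cos (y * t) * (y * 1) / y = Real.cos (y * t) := by field_simp
    rw [e] at h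
    exact h
  have step1 := integral_mul_deriv_eq_deriv_mul (u := φ) (u' := φ') (v := fun t ↦ Real.sin (y * t) / y)
    (v' := fun t ↦ Real.cos (y * t)) (a := 0) (b := X) (fun t _ ↦ hφ t) (fun t _ ↦ hsin t)
    (hφ'c.intervalIntegrable _ _) ((by fun_prop : Continuous fun t ↦ Real.cos (y * t)).intervalIntegrable _ _)
  -- second: `∫ φ' sin/y = [φ' (1 − cos)/y²] − ∫ φ'' (1 − cos)/y² = −y⁻² ∫ φ'' (1 − cos)`
  have hcos : ∀ t, HasDerivAt (fun t : ℝ ↦ (1 - Real.cos (y * t)) / y ^ 2) (Real.sin (y * t) / y) t := by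
    intro t
    have h := (((hasDerivAt_id' t).const_mul y).cos.const_sub 1).div_const (y ^ 2)
    have e : -(-Real.sin (y * t) * (y * 1)) / y ^ 2 = Real.sin (y * t) / y := by
      field_simp
    rw [e] at h
    exact h
  have step2 := integral_mul_deriv_eq_deriv_mul (u := φ') (u' := φ'')
    (v := fun t ↦ (1 - Real.cos (y * t)) / y ^ 2) (v' := fun t ↦ Real.sin (y * t) / y) (a := 0) (b := X)
    (fun t _ ↦ hφ' t) (fun t _ ↦ hcos t)
    (hφ''.intervalIntegrable _ _) ((by fun_prop : Continuous fun t ↦ Real.sin (y * t) / y).intervalIntegrable _ _)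
  simp only [hX0, hX1, mul_zero, Real.sin_zero, zero_div, Real.cos_zero, sub_self, zero_mul,
    zero_sub] at step1 step2
  rw [step1]
  have e2 : ∫ x : ℝ in (0 : ℝ)..X, φ' x * (Real.sin (y * x) / y) =
      -∫ x : ℝ in (0 : ℝ)..X, φ'' x * ((1 - Real.cos (y * x)) / y ^ 2) := step2
  rw [e2, neg_neg, ← intervalIntegral.integral_const_mul]
  refine intervalIntegral.integral_congr fun t _ ↦ ?_
  field_simp

/-- **Positivity** (Pólya's criterion, compact support): for `φ ∈ C²` with `φ'' ≥ 0` on `[0, X]`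
(`X ≥ 0`) and `φ(X) = φ'(X) = 0`, `∫₀^X φ(t) cos(yt) dt ≥ 0` for every real `y`.
[cite: HeathBrown1992PLMS, Section 7 (Condition 2)] -/
theorem integral_mul_cos_nonneg {φ φ' φ'' : ℝ → ℝ} {X : ℝ} (hX : 0 ≤ X)
    (hφ : ∀ t, HasDerivAt φ (φ' t) t) (hφ' : ∀ t, HasDerivAt φ' (φ'' t) t) (hφ'' : Continuous φ'')
    (hconv : ∀ t ∈ Icc 0 X, 0 ≤ φ'' t) (hX0 : φ X = 0) (hX1 : φ' X = 0) (y : ℝ) :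
    0 ≤ ∫ t in (0 : ℝ)..X, φ t * Real.cos (y * t) := by
  by_cases hy : y = 0
  · -- `φ ≥ 0` on `[0, X]`: `φ' ≤ 0` (as `φ'' ≥ 0`, `φ'(X) = 0`) and `φ(X) = 0`
    subst hy
    simp only [zero_mul, Real.cos_zero, mul_one]
    refine intervalIntegral.integral_nonneg hX fun t ht ↦ ?_
    -- `φ' ≤ 0` on `[t, X]`
    have hφ'le : ∀ u ∈ Icc t X, φ' u ≤ 0 := by
      intro u hu
      have hmono : MonotoneOn φ' (Icc 0 X) :=
        monotoneOn_of_hasDerivWithinAt_nonneg (convex_Icc 0 X)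
          (continuous_iff_continuousAt.2 fun t ↦ (hφ' t).continuousAt).continuousOn
          (fun u _ ↦ (hφ' u).hasDerivWithinAt) fun u hu' ↦ hconv u (interior_subset hu')
      have := hmono ⟨ht.1.trans hu.1, hu.2⟩ ⟨hX, le_rfl⟩ hu.2
      rwa [hX1] at this
    have hanti : AntitoneOn φ (Icc t X) :=
      antitoneOn_of_hasDerivWithinAt_nonpos (convex_Icc t X)
        (continuous_iff_continuousAt.2 fun t ↦ (hφ t).continuousAt).continuousOn
        (fun u _ ↦ (hφ u).hasDerivWithinAt) fun u hu ↦ hφ'le u (interior_subset hu)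
    have := hanti ⟨le_rfl, ht.2⟩ ⟨ht.2, le_rfl⟩ ht.2
    rwa [hX0] at this
  · rw [integral_mul_cos_eq hφ hφ' hφ'' hX0 hX1 hy]
    refine mul_nonneg (by positivity) (intervalIntegral.integral_nonneg hX fun t ht ↦ ?_)
    exact mul_nonneg (hconv t ht) (by linarith [Real.cos_le_one (y * t)])

/-- **The real part on a vertical line**: `Re Φ(a + iy) = ∫₀^X (φ(t) e^{−at}) cos(yt) dt`; combined
with `integral_mul_cos_nonneg` for `ψ = φ e^{−a·}` (convex, `ψ(X) = ψ'(X) = 0`) this gives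
Heath-Brown's Condition 2, `Re F(z) ≥ 0` for `Re z ≥ 0`. [cite: HeathBrown1992PLMS, Section 7 (Condition 2)] -/
theorem re_shapeLaplace_eq (φ : ℝ → ℝ) (hφ : Continuous φ) (X a y : ℝ) :
    (shapeLaplace φ X ((a : ℂ) + y * I)).re =
      ∫ t in (0 : ℝ)..X, (φ t * Real.exp (-(a * t))) * Real.cos (y * t) := by
  rw [shapeLaplace]
  have hint : IntervalIntegrable (fun t : ℝ ↦ (φ t : ℂ) * Complex.exp (-(((a : ℂ) + y * I) * t)))
      volume 0 X := ((continuous_ofReal.comp hφ).mul (Continuous.cexp (by fun_prop))).intervalIntegrable _ _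
  have hre := intervalIntegral.intervalIntegral_re hint
  simp only [RCLike.re_to_complex] at hre
  rw [← hre]
  refine intervalIntegral.integral_congr fun t _ ↦ ?_
  simp only [Complex.mul_re, Complex.ofReal_re, Complex.ofReal_im, zero_mul, sub_zero]
  rw [Complex.exp_re]
  simp only [neg_re, mul_re, add_re, ofReal_re, mul_re, I_re, mul_zero, ofReal_im, I_im, mul_one,
    sub_self, add_zero, add_im, mul_im, zero_add, neg_im, Real.cos_neg]
  ring_nf

end LaplaceShape

end Literature.NumberTheory.LFunctions

end
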